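import Summits.AnomalousDissipation.AnomalousDissipation.Theorems.SawtoothPulseCascadeK2PhaseTransferPoint
import HarnessLib
import HarnessLib.Audit

/-!
# VARIANT LINE SKETCH for `Target` = stmt-AnomalousDissipation-20024 (prover leafhand-ad-sawtoothpulsecasca-3 g0, 2026-08-31;
# NOT a registration — the registered skeleton of record is `Cruxes/K1LocalisedCascade/K2AssemblyS4.lean` (S4 v7, 912b689b)):
# ONE stub, the one-phase transfer inequality within the horizon at the design point `⟨8, 2⁻¹⁰⁰, 2, 1, 2⟩`, cap `5`.

`Target_holds := K2Classical.target_of_phaseTransferH_eight _ _ stub_pointTransferH` (tree theorem, p799789).  The stub is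
19696's registered stub B (`stub_phaseCocycle`, line `phase-cocycle`) specialised to `(γ, δ₀, ρN) = (8, 2⁻¹⁰⁰, 2)`, relaxed from
cap `3` to cap `5`, and guarded by the horizon `J + 1 < Jrate 61 ν + A` (threshold `ν₀` per lag `A`) — the weakest K2 statement the
landed closure consumes (`target_of_K2H_five`).  Why it might fail / what a proof must use: see the evidence notes
`evidence-19696-stubB-kelvin.md` (free Kelvin–Orr packets beat the cap: comb-generation is essential) and the S4 law book.
Farm check: rc 0, sorries 1 (`stub_pointTransferH`).
-/

set_option linter.dupNamespace false

noncomputable section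

namespace Summit.AnomalousDissipation.AnomalousDissipation.Cruxes.K2LinearisedCascadeGrowth.PointTransfer

open Set MeasureTheory
open Literature.Analysis Literature.Analysis.FunctionSpaces Literature.Analysis.FluidPDE
open Literature.Analysis.FluidPDE.SawtoothCascade
open Literature.Analysis.FluidPDE.SawtoothCascade.CascadeParams
open Summit.AnomalousDissipation.AnomalousDissipation.Theses.SawtoothPulseCascade
open Summit.AnomalousDissipation.AnomalousDissipation.Theorems.SawtoothPulseCascade

/-- The design rounding `δ₀ = 2⁻¹⁰⁰` (any `0 < δ₀ ≤ 2⁻¹⁰⁰` would do). -/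
def δ₀c : ℝ := (2 : ℝ)⁻¹ ^ 100

theorem δ₀c_pos : 0 < δ₀c := by unfold δ₀c; positivity

theorem δ₀c_le : δ₀c ≤ (2 : ℝ)⁻¹ ^ 100 := le_rfl

/-- THE STUB (XL): one-phase transfer within the horizon at `⟨8, δ₀c, 2, 1, 2⟩`, cap `5`, for comb-generated classical
linearised responses — per-phase `L²` amplification ≤ `5e^{8σ⋆} ≈ 59.6` given the energy history. -/
theorem stub_pointTransferH :
    ∀ A : ℕ, ∃ ν₀ : ℝ, 0 < ν₀ ∧ ∀ ν ∈ Ioc 0 ν₀, ∀ (j₀ J : ℕ), j₀ ≤ J →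
      J + 1 < Jrate ((8 : ℝ) ^ 2 - 3) ν + A → ∀ (hz : Bool)
      (w₀ : UnitAddTorus (Fin 2) → EuclideanSpace ℝ (Fin 2))
      (w : ℝ → UnitAddTorus (Fin 2) → EuclideanSpace ℝ (Fin 2)) (q : ℝ → UnitAddTorus (Fin 2) → ℝ),
      ShearCombDatum (((⟨8, δ₀c, 2, 1, 2⟩ : CascadeParams)).N j₀) hz w₀ →
      Torus.IsSmoothSpaceTimeOn (Icc (CascadeParams.tInject j₀ hz) (tStart (J + 2))) w →
      Torus.IsSmoothSpaceTimeOn (Icc (CascadeParams.tInject j₀ hz) (tStart (J + 2))) q →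
      (∀ t ∈ Icc (CascadeParams.tInject j₀ hz) (tStart (J + 2)), Torus.IsDivFree (w t)) →
      (∀ t ∈ Icc (CascadeParams.tInject j₀ hz) (tStart (J + 2)), ∀ x,
        Torus.timeDerivWithin (Icc (CascadeParams.tInject j₀ hz) (tStart (J + 2))) w t x +
          Torus.convect ((⟨8, δ₀c, 2, 1, 2⟩ : CascadeParams).field t) (w t) x +
          Torus.convect (w t) ((⟨8, δ₀c, 2, 1, 2⟩ : CascadeParams).field t) x =
          ν • Torus.laplacian (w t) x - Torus.gradient (q t) x) →
      w (CascadeParams.tInject j₀ hz) = w₀ →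
      ∀ B : ℝ, (∀ t ∈ Icc (CascadeParams.tInject j₀ hz) (tStart (J + 1)), Torus.vectorL2Sq (w t) ≤ B) →
      ∀ t ∈ Icc (tStart (J + 1)) (tStart (J + 2)),
        Torus.vectorL2Sq (w t) ≤ (5 * Real.exp (sawSigmaStar * 8)) ^ 2 * B := by
  sorry

/-- **`Target` BY NAME from the single stub** (`K2Classical.target_of_phaseTransferH_eight`, p799789). -/
theorem Target_holds : Target :=
  K2Classical.target_of_phaseTransferH_eight δ₀c_pos δ₀c_le stub_pointTransferH

end Summit.AnomalousDissipation.AnomalousDissipation.Cruxes.K2LinearisedCascadeGrowth.PointTransfer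

end
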